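import Literature.Geometry.Kaehler.ComplexTorusHodgeGroupSigmaPi
import HarnessLib

/-!
# Moonen–Zarhin §1 for factors of arbitrary dimensions: `Hg(X₁^{n₁} × ⋯ × X_r^{n_r}) ≅ Hg(X₁ × ⋯ × X_r)` on the
# dependent product `sigmaPiPeriod` (real and complex points), and `Hg(X) ≅ Hg(Y₁ × ⋯ × Y_r)` for the simple
# Poincaré factors of every polarised torus

Layer `Literature/Geometry/Kaehler`, namespace `Literature.Geometry.Kaehler.ComplexTorus`; lane `lit-hodgefound`
(Track 2 foundations library), Layer A3 (Hodge groups of products); prover seat `lit-hodgefound-p36` (generation 15,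
self-proposed row g15-#4, sequel of g15-#1 `ComplexTorusHodgeGroupSigmaPi` — `sigmaPiEqs`, `sigmaBlockDiagSL`,
`hodgeCircle_sigmaPiPeriod`, `hodgeGroup_sigmaPi_le`, `det_blockDiagonal'_eq_prod`, consumed BY NAME). The carrier is
p10's DEPENDENT finite product `∏ₖ X_k = ComplexTorus (sigmaPiPeriod Ψ)` of tori `Ψ k : ℝ^{σ k} ≃L[ℝ] F k` of
DIFFERENT dimensions, and `∏ₖ X_k^{n_k} = sigmaPiPeriod (fun k ↦ powPeriod (Ψ k) (n k))`.

The tree proves Moonen–Zarhin's identification for ONE factor (`hodgeGroup_pow`, `mem_hodgeGroupC_pow_iff`, through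
p40's `isPolyGroupIso_diagPowMap`) and for TWO factors (`isPolyGroupIso_prodDiagPowMap`, `hodgeGroup_prod_pow`,
`hodgeGroupProdPowMulEquiv` of `ComplexTorusHodgeGroupFunctoriality` §4); this file proves it for ANY finite family of
factors of any dimensions — the shape in which Poincaré's complete reducibility theorem
(`poincare_complete_reducibility_powers`) delivers a polarised torus — by the same GGK (I.B.4) transport
(`IsPolyGroupIso`, `IsPolyGroupIso.mem_hodgeGroup_iff` / `.mem_hodgeGroupC_iff` / `.hodgeGroupC_comm_iff`, BY NAME)
along the polynomial map `δ = ⊕ₖ Δ_{n_k}` with the NON-EMPTY domain family of block-diagonal matrices (where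
`Hg(∏ₖ X_k)` lives, GGK III.B (i) = g15-#1), written on Mathlib's `Matrix.blockDiagonal'` / `Matrix.blockDiag'`.
Small definitions WITH BODIES (`sigmaDiagPowMap`, `sigmaLayer`, `sigmaDiagPowProj`, `sigmaDiagPowSL`,
`hodgeGroupSigmaPiPowMulEquiv`); everything else is a PROVED theorem; no named fact (D-0026, net debt 0).

## Source, verbatim

B. J. J. Moonen, Yu. G. Zarhin, *Hodge classes on abelian varieties of low dimension*, Math. Ann. 315 (1999)
(held `paper:arxiv-math_9901113`), §1 (p0002 L138–L141): "For `n ≥ 1` we can identify `Hg(Xⁿ)` with `Hg(X)`,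
acting diagonally on `V_{Xⁿ} = (V_X)ⁿ`. More generally, if `n₁, …, n_r ∈ ℤ_{≥1}` then we can identify
`Hg(X₁^{n₁} × ⋯ × X_r^{n_r})` with `Hg(X₁ × ⋯ × X_r)`."; (0.2)(4) (p0002 L1–L3, L9–L11): "Decompose `X`, up to
isogeny, as a product of elementary abelian varieties, say `X ∼ Y₁^{m₁} × ⋯ × Y_r^{m_r}`. […] we require the `Y_j`
to be simple, pairwise non-isogenous, and the `m_j` are positive integers."
M. Green, P. Griffiths, M. Kerr, *Mumford–Tate Groups and Domains* (2012), §I.B (I.B.4) (morphisms defined over `ℚ`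
and `ℚ`-closures) and §III.B (i) (p. 72: `M_{φ₁+φ₂} ⊂ M_{φ₁} × M_{φ₂}`).

## What is proved

* §1 `sigmaDiagPowMap σ n` (`δ`), **`peval_sigmaDiagPowMap : δ(M) = diag_k(1_{n_k} ⊗ₖ M_{kk})`**, the layer inverse
  `sigmaDiagPowProj σ n e` (`ψ`, `peval_sigmaDiagPowProj`), `submatrix_sigmaLayer_blockDiagonal'`,
  `peval_sigmaDiagPowProj_peval_sigmaDiagPowMap`, `eq_blockDiagonal'_one_kronecker_of_mem_ratZeroLocus`,
  **`isPolyGroupIso_sigmaDiagPowMap`** (domain `sigmaPiEqs (fun _ ↦ ∅)`, codomain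
  `sigmaPiEqs fun k ↦ diagPowEqs (σ k) (n k) (e k)`).
* §2 the hom **`sigmaDiagPowSL σ n : (∀ k, SL(V_k)(ℝ)) →* SL(⊕ₖ V_k^{n_k})(ℝ)`**, `coe_sigmaDiagPowSL`,
  `sigmaDiagPowSL_injective` (`n_k ≥ 1`), `peval_sigmaDiagPowMap_coe_sigmaBlockDiagSL`.
* §3 `peval_sigmaDiagPowMap_hodgeCircle_sigmaPiPeriod` (`h_{∏ X_k^{n_k}} = δ ∘ h_{∏ X_k}`); REAL points
  **`mem_hodgeGroup_sigmaPi_pow_iff`**, **`hodgeGroup_sigmaPi_pow_eq : Hg(∏ₖ X_k^{n_k})(ℝ) =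
  ((Hg(∏ₖ X_k)(ℝ)).comap sigmaBlockDiagSL).map sigmaDiagPowSL`**, **`hodgeGroupSigmaPiPowMulEquiv :
  Hg(∏ₖ X_k)(ℝ) ≃* Hg(∏ₖ X_k^{n_k})(ℝ)`**, `hodgeGroup_sigmaPi_pow_comm_iff`; COMPLEX points
  **`mem_hodgeGroupC_sigmaPi_pow_iff`** and **`hodgeGroupC_sigmaPi_pow_comm_iff`**.
* §4 **`IsIsogenous.nonempty_hodgeGroup_mulEquiv_sigmaPi_of_powers`: `X ∼ ∏ₖ Y_k^{m_k}` (`m_k ≥ 1`, `Y_k` of any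
  dimensions) ⟹ `Hg(X)(ℝ) ≃* Hg(∏ₖ Y_k)(ℝ)`**, and **`IsRiemannForm.exists_nonempty_hodgeGroup_mulEquiv_sigmaPi_simple`**:
  every polarised torus has simple, pairwise non-isogenous Poincaré factors `Y_ν` with `X ∼ ∏_ν Y_ν^{n_ν}` and
  `Hg(X)(ℝ) ≃* Hg(∏_ν Y_ν)(ℝ)`.

## References

* [MoonenZarhin1999LowDim] B. J. J. Moonen, Yu. G. Zarhin, *Hodge classes on abelian varieties of low dimension*,
  Math. Ann. 315 (1999), 711–733, (0.2)(4) and §1.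
* [GreenGriffithsKerr2012] M. Green, P. Griffiths, M. Kerr, *Mumford–Tate Groups and Domains*, Ann. of Math. Stud.
  183 (2012), §I.B (I.B.3), (I.B.4); §III.B (i).
* [Lange2023AbelianVarietiesComplex] H. Lange, *Abelian Varieties over the Complex Numbers* (2023), §2.4.4 Thm. 2.4.25.
* [HornJohnson2013] R. A. Horn, C. R. Johnson, *Matrix Analysis*, 2nd ed. (2013), §0.9.2.
-/

noncomputable section

open scoped Real Kronecker
open Set Function Complex Module Matrix

namespace Literature.Geometry.Kaehler

namespace ComplexTorus

open PolyMatrixMap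

/-! ## §1 The polynomial map `δ = ⊕ₖ Δ_{n_k}` and its inverse -/

section PolyMaps

variable {κ : Type*} [Fintype κ] [DecidableEq κ] (σ : κ → Type*) [∀ k, Fintype (σ k)] [∀ k, DecidableEq (σ k)]
  (n : κ → ℕ)

/-- **`δ = Δ_{n₁} ⊕ ⋯ ⊕ Δ_{n_r}` as a `ℚ`-polynomial map of matrix spaces** `M(⊕ₖ V_k) → M(⊕ₖ V_k^{n_k})`:
`M ↦ diag_k(1_{n_k} ⊗ M_{kk})` (the off-diagonal blocks of the source are discarded — `Hg(∏ₖ X_k)` is block diagonal).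
[cite: MoonenZarhin1999LowDim, §1 (p0002 L138–L141)] [cite: GreenGriffithsKerr2012, §I.B (I.B.4)] -/
def sigmaDiagPowMap : PolyMatrixMap (Σ k, σ k) (Σ k, Fin (n k) × σ k) :=
  Matrix.of fun p q ↦
    if p.1 = q.1 ∧ (p.2.1 : ℕ) = (q.2.1 : ℕ) then MvPolynomial.X (⟨p.1, p.2.2⟩, ⟨q.1, q.2.2⟩) else 0

omit [Fintype κ] [∀ k, Fintype (σ k)] [∀ k, DecidableEq (σ k)] in
/-- **`δ(M) = diag_k(1_{n_k} ⊗ₖ M_{kk})`.** [cite: MoonenZarhin1999LowDim, §1 (p0002 L138–L141)] -/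
theorem peval_sigmaDiagPowMap {R : Type*} [CommRing R] [Algebra ℚ R] (M : Matrix (Σ k, σ k) (Σ k, σ k) R) :
    (sigmaDiagPowMap σ n).peval M =
      Matrix.blockDiagonal' fun k ↦ (1 : Matrix (Fin (n k)) (Fin (n k)) R) ⊗ₖ Matrix.blockDiag' M k := by
  ext ⟨k, a, i⟩ ⟨l, b, j⟩
  rw [peval_apply, sigmaDiagPowMap, Matrix.of_apply]
  by_cases hkl : k = l
  · subst hkl
    rw [Matrix.blockDiagonal'_apply_eq, Matrix.kroneckerMap_apply, Matrix.one_apply, Matrix.blockDiag'_apply]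
    by_cases hab : a = b
    · subst hab
      rw [if_pos ⟨rfl, rfl⟩, evalMat_X, if_pos rfl, one_mul]
    · rw [if_neg fun h ↦ hab (Fin.ext h.2), map_zero, if_neg hab, zero_mul]
  · rw [Matrix.blockDiagonal'_apply_ne _ _ _ hkl, if_neg fun h ↦ hkl h.1, map_zero]

/-- The layer embedding `(k, i) ↦ (k, (e_k, i))` picking the `e_k`-th copy of `V_k` inside `V_k^{n_k}`.
[cite: MoonenZarhin1999LowDim, §1 (p0002 L138–L141)] -/
def sigmaLayer (e : ∀ k, Fin (n k)) : (Σ k, σ k) → Σ k, Fin (n k) × σ k := fun p ↦ ⟨p.1, (e p.1, p.2)⟩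

/-- **The inverse `ψ`: the `(e_k, e_k)` sub-blocks** `N ↦ (N_{(k,e_k,i),(l,e_l,j)})`, a polynomial map.
[cite: MoonenZarhin1999LowDim, §1 (p0002 L138–L141)] [cite: GreenGriffithsKerr2012, §I.B (I.B.4)] -/
def sigmaDiagPowProj (e : ∀ k, Fin (n k)) : PolyMatrixMap (Σ k, Fin (n k) × σ k) (Σ k, σ k) :=
  Matrix.of fun p q ↦ MvPolynomial.X (sigmaLayer σ n e p, sigmaLayer σ n e q)

omit [Fintype κ] [DecidableEq κ] [∀ k, Fintype (σ k)] [∀ k, DecidableEq (σ k)] in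
/-- `ψ(N)` is the `sigmaLayer` submatrix. [cite: MoonenZarhin1999LowDim, §1 (p0002 L138–L141)] -/
theorem peval_sigmaDiagPowProj (e : ∀ k, Fin (n k)) {R : Type*} [CommRing R] [Algebra ℚ R]
    (N : Matrix (Σ k, Fin (n k) × σ k) (Σ k, Fin (n k) × σ k) R) :
    (sigmaDiagPowProj σ n e).peval N = N.submatrix (sigmaLayer σ n e) (sigmaLayer σ n e) := by
  ext p q
  rw [peval_apply, sigmaDiagPowProj, Matrix.of_apply, evalMat_X, Matrix.submatrix_apply]

omit [Fintype κ] [∀ k, Fintype (σ k)] [∀ k, DecidableEq (σ k)] in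
/-- The layer submatrix of a block-diagonal matrix is block diagonal with the layer sub-blocks.
[cite: HornJohnson2013, §0.9.2 (block diagonal matrices and direct sums)] -/
theorem submatrix_sigmaLayer_blockDiagonal' (e : ∀ k, Fin (n k)) {R : Type*} [Zero R]
    (d : ∀ k, Matrix (Fin (n k) × σ k) (Fin (n k) × σ k) R) :
    (Matrix.blockDiagonal' d).submatrix (sigmaLayer σ n e) (sigmaLayer σ n e) =
      Matrix.blockDiagonal' fun k ↦ (d k).submatrix (Prod.mk (e k)) (Prod.mk (e k)) := by
  ext ⟨k, i⟩ ⟨l, j⟩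
  rw [Matrix.submatrix_apply]
  by_cases hkl : k = l
  · subst hkl
    rw [sigmaLayer, sigmaLayer, Matrix.blockDiagonal'_apply_eq, Matrix.blockDiagonal'_apply_eq,
      Matrix.submatrix_apply]
  · rw [sigmaLayer, sigmaLayer, Matrix.blockDiagonal'_apply_ne _ _ _ hkl, Matrix.blockDiagonal'_apply_ne _ _ _ hkl]

omit [Fintype κ] [∀ k, Fintype (σ k)] [∀ k, DecidableEq (σ k)] in
/-- `ψ(δ(M)) = diag_k(M_{kk})`. [cite: MoonenZarhin1999LowDim, §1 (p0002 L138–L141)] -/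
theorem peval_sigmaDiagPowProj_peval_sigmaDiagPowMap (e : ∀ k, Fin (n k)) {R : Type*} [CommRing R] [Algebra ℚ R]
    (M : Matrix (Σ k, σ k) (Σ k, σ k) R) :
    (sigmaDiagPowProj σ n e).peval ((sigmaDiagPowMap σ n).peval M) =
      Matrix.blockDiagonal' (Matrix.blockDiag' M) := by
  rw [peval_sigmaDiagPowProj, peval_sigmaDiagPowMap, submatrix_sigmaLayer_blockDiagonal']
  congr 1
  funext k
  exact submatrix_one_kronecker (n k) (e k) _

omit [Fintype κ] [∀ k, Fintype (σ k)] [∀ k, DecidableEq (σ k)] in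
/-- An element of `V(L)`, `L = diag_k(Δ_{n_k}-equations)`, is `diag_k(1_{n_k} ⊗ₖ S_k)` with `S_k` its `(e_k, e_k)`
sub-block. [cite: MoonenZarhin1999LowDim, §1 (p0002 L138–L141)] -/
theorem eq_blockDiagonal'_one_kronecker_of_mem_ratZeroLocus (e : ∀ k, Fin (n k)) {R : Type*} [CommRing R]
    [Algebra ℚ R] {N : Matrix (Σ k, Fin (n k) × σ k) (Σ k, Fin (n k) × σ k) R}
    (hN : N ∈ ratZeroLocus R (sigmaPiEqs fun k ↦ diagPowEqs (σ k) (n k) (e k))) :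
    N = Matrix.blockDiagonal' fun k ↦ (1 : Matrix (Fin (n k)) (Fin (n k)) R) ⊗ₖ
      (Matrix.blockDiag' N k).submatrix (Prod.mk (e k)) (Prod.mk (e k)) := by
  obtain ⟨hoff, hdiag⟩ := (mem_ratZeroLocus_sigmaPiEqs_iff _ N).1 hN
  conv_lhs => rw [eq_blockDiagonal'_blockDiag'_of_apply_eq_zero hoff]
  congr 1
  funext k
  exact (mem_ratZeroLocus_diagPowEqs_iff (n k) (e k) _).1 (hdiag k)

omit [Fintype κ] [∀ k, Fintype (σ k)] [∀ k, DecidableEq (σ k)] in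
/-- `ψ` of an element of `V(L)` is `diag_k(S_k)`. [cite: MoonenZarhin1999LowDim, §1 (p0002 L138–L141)] -/
theorem peval_sigmaDiagPowProj_of_mem_ratZeroLocus (e : ∀ k, Fin (n k)) {R : Type*} [CommRing R] [Algebra ℚ R]
    {N : Matrix (Σ k, Fin (n k) × σ k) (Σ k, Fin (n k) × σ k) R}
    (hN : N ∈ ratZeroLocus R (sigmaPiEqs fun k ↦ diagPowEqs (σ k) (n k) (e k))) :
    (sigmaDiagPowProj σ n e).peval N =
      Matrix.blockDiagonal' fun k ↦ (Matrix.blockDiag' N k).submatrix (Prod.mk (e k)) (Prod.mk (e k)) := by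
  rw [peval_sigmaDiagPowProj]
  conv_lhs => rw [eq_blockDiagonal'_one_kronecker_of_mem_ratZeroLocus σ n e hN]
  rw [submatrix_sigmaLayer_blockDiagonal']
  congr 1
  funext k
  exact submatrix_one_kronecker (n k) (e k) _

omit [∀ k, DecidableEq (σ k)] in
/-- The diagonal blocks of a product of two block-diagonal matrices. [cite: HornJohnson2013, §0.9.2 (block diagonal matrices and direct sums)] -/
theorem blockDiag'_mul_of_mem_ratZeroLocus {R : Type*} [CommRing R] [Algebra ℚ R]
    {P : ∀ k, Set (MvPolynomial (σ k × σ k) ℚ)} {M N : Matrix (Σ k, σ k) (Σ k, σ k) R}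
    (hM : M ∈ ratZeroLocus R (sigmaPiEqs P)) (hN : N ∈ ratZeroLocus R (sigmaPiEqs P)) :
    Matrix.blockDiag' (M * N) = fun k ↦ Matrix.blockDiag' M k * Matrix.blockDiag' N k := by
  conv_lhs => rw [eq_blockDiagonal'_blockDiag'_of_apply_eq_zero ((mem_ratZeroLocus_sigmaPiEqs_iff _ M).1 hM).1,
    eq_blockDiagonal'_blockDiag'_of_apply_eq_zero ((mem_ratZeroLocus_sigmaPiEqs_iff _ N).1 hN).1,
    ← Matrix.blockDiagonal'_mul]
  exact Matrix.blockDiag'_blockDiagonal' _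

/-- **`δ = ⊕ₖ Δ_{n_k}` is a polynomial group isomorphism of the block-diagonal `ℚ`-subgroup
`∏ₖ GL(V_k) ⊆ GL(⊕ₖ V_k)` onto the `ℚ`-subgroup `∏ₖ Δ_{n_k} GL(V_k) ⊆ GL(⊕ₖ V_k^{n_k})`** (`n_k ≥ 1`, witnessed by
the layers `e_k`). [cite: GreenGriffithsKerr2012, §I.B (I.B.4)] [cite: MoonenZarhin1999LowDim, §1 (p0002 L138–L141)] -/
theorem isPolyGroupIso_sigmaDiagPowMap (e : ∀ k, Fin (n k)) :
    IsPolyGroupIso (sigmaPiEqs fun k ↦ (∅ : Set (MvPolynomial (σ k × σ k) ℚ)))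
      (sigmaPiEqs fun k ↦ diagPowEqs (σ k) (n k) (e k)) (sigmaDiagPowMap σ n) (sigmaDiagPowProj σ n e) := by
  have hn : ∀ k, n k ≠ 0 := fun k h ↦ Fin.elim0 (h ▸ e k : Fin 0)
  refine ⟨isRatAlgSubgroupEqs_sigmaPiEqs fun _ ↦ isRatAlgSubgroupEqs_empty, ?_, fun M N _ _ hMD hND ↦ ?_,
    fun M _ _ ↦ ?_, fun M _ hMD ↦ ?_, fun N hN hNL ↦ ⟨?_, ?_⟩, fun N _ hNL ↦ ?_⟩
  · simp only [peval_sigmaDiagPowMap, Matrix.blockDiag'_one, Pi.one_apply, Matrix.one_kronecker_one]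
    exact Matrix.blockDiagonal'_one
  · rw [peval_sigmaDiagPowMap, peval_sigmaDiagPowMap, peval_sigmaDiagPowMap,
      blockDiag'_mul_of_mem_ratZeroLocus σ hMD hND, ← Matrix.blockDiagonal'_mul]
    congr 1
    funext k
    rw [← Matrix.mul_kronecker_mul, Matrix.one_mul]
  · rw [peval_sigmaDiagPowMap, blockDiagonal'_mem_ratZeroLocus_sigmaPiEqs_iff]
    exact fun k ↦ one_kronecker_mem_ratZeroLocus_diagPowEqs (n k) (e k) _
  · rw [peval_sigmaDiagPowProj_peval_sigmaDiagPowMap]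
    exact (eq_blockDiagonal'_blockDiag'_of_apply_eq_zero ((mem_ratZeroLocus_sigmaPiEqs_iff _ M).1 hMD).1).symm
  · rw [peval_sigmaDiagPowProj_of_mem_ratZeroLocus σ n e hNL, blockDiagonal'_mem_ratZeroLocus_sigmaPiEqs_iff]
    exact fun _ _ h ↦ h.elim
  · rw [eq_blockDiagonal'_one_kronecker_of_mem_ratZeroLocus σ n e hNL, det_blockDiagonal'_eq_prod,
      isUnit_iff_ne_zero, Finset.prod_ne_zero_iff] at hN
    rw [peval_sigmaDiagPowProj_of_mem_ratZeroLocus σ n e hNL, det_blockDiagonal'_eq_prod, isUnit_iff_ne_zero,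
      Finset.prod_ne_zero_iff]
    intro k hk h0
    refine hN k hk ?_
    rw [det_one_kronecker, h0, zero_pow (hn k)]
  · rw [peval_sigmaDiagPowProj_of_mem_ratZeroLocus σ n e hNL, peval_sigmaDiagPowMap, Matrix.blockDiag'_blockDiagonal']
    exact (eq_blockDiagonal'_one_kronecker_of_mem_ratZeroLocus σ n e hNL).symm

end PolyMaps

/-! ## §2 The group homomorphism `(A_k)_k ↦ diag_k(Δ_{n_k} A_k)` on real points -/

section DiagPowSL

variable {κ : Type*} [Fintype κ] [DecidableEq κ] (σ : κ → Type*) [∀ k, Fintype (σ k)] [∀ k, DecidableEq (σ k)]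
  (n : κ → ℕ)

/-- **`(A_k)_k ↦ diag(Δ_{n₁} A₁, …, Δ_{n_r} A_r)`**: `∏ₖ SL(V_k) → SL(⊕ₖ V_k^{n_k})` on real points
(`sigmaBlockDiagSL ∘ ∏ₖ diagPowSL`). [cite: MoonenZarhin1999LowDim, §1 (p0002 L138–L141)] -/
def sigmaDiagPowSL : (∀ k, SpecialLinearGroup (σ k) ℝ) →* SpecialLinearGroup (Σ k, Fin (n k) × σ k) ℝ :=
  (sigmaBlockDiagSL (fun k ↦ Fin (n k) × σ k) ℝ).comp
    { toFun := fun A k ↦ diagPowSL (σ k) (n k) (A k)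
      map_one' := funext fun k ↦ by rw [Pi.one_apply, map_one]; rfl
      map_mul' := fun A B ↦ funext fun k ↦ by rw [Pi.mul_apply, map_mul]; rfl }

/-- The matrix of `sigmaDiagPowSL σ n A` is `diag_k(1_{n_k} ⊗ₖ A_k)`. [cite: MoonenZarhin1999LowDim, §1 (p0002 L138–L141)] -/
theorem coe_sigmaDiagPowSL (A : ∀ k, SpecialLinearGroup (σ k) ℝ) :
    (sigmaDiagPowSL σ n A : Matrix (Σ k, Fin (n k) × σ k) (Σ k, Fin (n k) × σ k) ℝ) =
      Matrix.blockDiagonal' fun k ↦ (1 : Matrix (Fin (n k)) (Fin (n k)) ℝ) ⊗ₖ (A k : Matrix (σ k) (σ k) ℝ) := by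
  rw [sigmaDiagPowSL, MonoidHom.comp_apply, coe_sigmaBlockDiagSL]
  congr 1
  funext k
  exact (coe_diagPowSL (n k) (A k)).trans (diagPow_eq_one_kronecker (n k) _)

/-- `sigmaDiagPowSL` is injective for `n_k ≥ 1`. [cite: MoonenZarhin1999LowDim, §1 (p0002 L138–L141: "identify")] -/
theorem sigmaDiagPowSL_injective (hn : ∀ k, 0 < n k) : Injective (sigmaDiagPowSL σ n) :=
  sigmaBlockDiagSL_injective.comp fun _ _ h ↦ funext fun k ↦ diagPowSL_injective (n k) (hn k) (congrFun h k)

/-- `δ(diag_k(A_k)) = sigmaDiagPowSL (A_k)_k` on matrices. [cite: MoonenZarhin1999LowDim, §1 (p0002 L138–L141)] -/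
theorem peval_sigmaDiagPowMap_coe_sigmaBlockDiagSL (A : ∀ k, SpecialLinearGroup (σ k) ℝ) :
    (sigmaDiagPowMap σ n).peval (sigmaBlockDiagSL σ ℝ A : Matrix (Σ k, σ k) (Σ k, σ k) ℝ) =
      (sigmaDiagPowSL σ n A : Matrix (Σ k, Fin (n k) × σ k) (Σ k, Fin (n k) × σ k) ℝ) := by
  rw [peval_sigmaDiagPowMap, coe_sigmaBlockDiagSL, Matrix.blockDiag'_blockDiagonal', coe_sigmaDiagPowSL]

end DiagPowSL

/-! ## §3 `Hg(∏ₖ X_k^{n_k}) ≅ Hg(∏ₖ X_k)`: real and complex points -/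

section HodgeGroup

variable {κ : Type*} [Fintype κ] [DecidableEq κ] {σ : κ → Type*} [∀ k, Fintype (σ k)] [∀ k, DecidableEq (σ k)]
  {F : κ → Type*} [∀ k, NormedAddCommGroup (F k)] [∀ k, NormedSpace ℂ (F k)]
  (Ψ : ∀ k, (σ k → ℝ) ≃L[ℝ] F k) (n : κ → ℕ)

/-- `h_{∏ X_k}(S¹)` lies in the block-diagonal domain `V(D)`, `D = sigmaPiEqs (fun _ ↦ ∅)`.
[cite: GreenGriffithsKerr2012, §III.B (i) (p. 72)] -/
theorem hodgeCircle_sigmaPiPeriod_mem_ratZeroLocus_sigmaPiEqs_empty (θ : ℝ) :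
    hodgeCircle (sigmaPiPeriod Ψ) θ ∈ ratZeroLocus ℝ (sigmaPiEqs fun k ↦ (∅ : Set (MvPolynomial (σ k × σ k) ℚ))) := by
  rw [hodgeCircle_sigmaPiPeriod, blockDiagonal'_mem_ratZeroLocus_sigmaPiEqs_iff]
  exact fun _ _ h ↦ h.elim

/-- **`h_{∏ X_k^{n_k}}(e^{iθ}) = δ(h_{∏ X_k}(e^{iθ}))`**: the Hodge structure of `∏ₖ X_k^{n_k}` is the diagonal one.
[cite: MoonenZarhin1999LowDim, §1 (p0002 L138–L141: "acting diagonally on `V_{Xⁿ} = (V_X)ⁿ`")] -/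
theorem peval_sigmaDiagPowMap_hodgeCircle_sigmaPiPeriod (θ : ℝ) :
    (sigmaDiagPowMap σ n).peval (hodgeCircle (sigmaPiPeriod Ψ) θ) =
      hodgeCircle (sigmaPiPeriod fun k ↦ powPeriod (Ψ k) (n k)) θ := by
  rw [peval_sigmaDiagPowMap, hodgeCircle_sigmaPiPeriod, Matrix.blockDiag'_blockDiagonal', hodgeCircle_sigmaPiPeriod]
  congr 1
  funext k
  exact (hodgeCircle_powPeriod (n k) (Ψ k) θ).symm

/-- **Moonen–Zarhin §1 on elements, real points, factors of any dimensions: `N ∈ Hg(∏ₖ X_k^{n_k})(ℝ)` iff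
`N = diag_k(Δ_{n_k} A_k)` for a (block-diagonal, GGK III.B (i)) element `diag_k(A_k) ∈ Hg(∏ₖ X_k)(ℝ)`** (`n_k ≥ 1`).
[cite: MoonenZarhin1999LowDim, §1 (p0002 L138–L141)] [cite: GreenGriffithsKerr2012, §I.B (I.B.4), §III.B (i)] -/
theorem mem_hodgeGroup_sigmaPi_pow_iff (hn : ∀ k, 0 < n k) {N : SpecialLinearGroup (Σ k, Fin (n k) × σ k) ℝ} :
    N ∈ hodgeGroup (sigmaPiPeriod fun k ↦ powPeriod (Ψ k) (n k)) ↔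
      ∃ A : ∀ k, SpecialLinearGroup (σ k) ℝ,
        sigmaBlockDiagSL σ ℝ A ∈ hodgeGroup (sigmaPiPeriod Ψ) ∧ sigmaDiagPowSL σ n A = N := by
  rw [(isPolyGroupIso_sigmaDiagPowMap σ n fun k ↦ ⟨0, hn k⟩).mem_hodgeGroup_iff (Φ := sigmaPiPeriod Ψ)
    (Φ' := sigmaPiPeriod fun k ↦ powPeriod (Ψ k) (n k))
    (hodgeCircle_sigmaPiPeriod_mem_ratZeroLocus_sigmaPiEqs_empty Ψ)
    (peval_sigmaDiagPowMap_hodgeCircle_sigmaPiPeriod Ψ n)]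
  constructor
  · rintro ⟨M, hM, hMN⟩
    obtain ⟨A, -, rfl⟩ := exists_eq_sigmaBlockDiagSL_of_mem_hodgeGroup_sigmaPi Ψ hM
    exact ⟨A, hM, Subtype.ext (by rw [← hMN, peval_sigmaDiagPowMap_coe_sigmaBlockDiagSL])⟩
  · rintro ⟨A, hA, rfl⟩
    exact ⟨_, hA, peval_sigmaDiagPowMap_coe_sigmaBlockDiagSL σ n A⟩

/-- **Moonen–Zarhin 1999 §1, real points, factors OF ANY DIMENSIONS: "if `n₁, …, n_r ∈ ℤ_{≥1}` then we can
identify `Hg(X₁^{n₁} × ⋯ × X_r^{n_r})` with `Hg(X₁ × ⋯ × X_r)`"** — `Hg(∏ₖ X_k^{n_k})(ℝ) = δ(Hg(∏ₖ X_k)(ℝ))` with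
`δ = sigmaDiagPowSL ∘ sigmaBlockDiagSL⁻¹`. [cite: MoonenZarhin1999LowDim, §1 (p0002 L138–L141)] [cite: GreenGriffithsKerr2012, §I.B (I.B.4)] -/
theorem hodgeGroup_sigmaPi_pow_eq (hn : ∀ k, 0 < n k) :
    hodgeGroup (sigmaPiPeriod fun k ↦ powPeriod (Ψ k) (n k)) =
      ((hodgeGroup (sigmaPiPeriod Ψ)).comap (sigmaBlockDiagSL σ ℝ)).map (sigmaDiagPowSL σ n) := by
  ext N
  rw [mem_hodgeGroup_sigmaPi_pow_iff Ψ n hn, Subgroup.mem_map]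
  simp only [Subgroup.mem_comap]

/-- `Hg(∏ₖ X_k)(ℝ)` lies in the range of the block-diagonal embedding. [cite: GreenGriffithsKerr2012, §III.B (i) (p. 72)] -/
theorem hodgeGroup_sigmaPi_le_range : hodgeGroup (sigmaPiPeriod Ψ) ≤ (sigmaBlockDiagSL σ ℝ).range :=
  (hodgeGroup_sigmaPi_le Ψ).trans (Subgroup.map_le_range _ _)

/-- **`Hg(X₁ × ⋯ × X_r)(ℝ) ≃* Hg(X₁^{n₁} × ⋯ × X_r^{n_r})(ℝ)`** for factors of any dimensions and `n_k ≥ 1`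
(the identification as a group isomorphism). [cite: MoonenZarhin1999LowDim, §1 (p0002 L138–L141)] -/
def hodgeGroupSigmaPiPowMulEquiv (hn : ∀ k, 0 < n k) :
    hodgeGroup (sigmaPiPeriod Ψ) ≃* hodgeGroup (sigmaPiPeriod fun k ↦ powPeriod (Ψ k) (n k)) :=
  ((MulEquiv.subgroupCongr (Subgroup.map_comap_eq_self (hodgeGroup_sigmaPi_le_range Ψ)).symm).trans
    (((hodgeGroup (sigmaPiPeriod Ψ)).comap (sigmaBlockDiagSL σ ℝ)).equivMapOfInjective _
      sigmaBlockDiagSL_injective).symm).trans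
    ((((hodgeGroup (sigmaPiPeriod Ψ)).comap (sigmaBlockDiagSL σ ℝ)).equivMapOfInjective _
      (sigmaDiagPowSL_injective σ n hn)).trans (MulEquiv.subgroupCongr (hodgeGroup_sigmaPi_pow_eq Ψ n hn).symm))

/-- **Moonen–Zarhin §1 on elements, COMPLEX points, factors of any dimensions: `N ∈ Hg(∏ₖ X_k^{n_k})(ℂ)` iff
`N = diag_k(1_{n_k} ⊗ M_{kk})` for some `M ∈ Hg(∏ₖ X_k)(ℂ)`** (`n_k ≥ 1`).
[cite: MoonenZarhin1999LowDim, §1 (p0002 L138–L141)] [cite: GreenGriffithsKerr2012, §I.B (I.B.3), (I.B.4)] -/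
theorem mem_hodgeGroupC_sigmaPi_pow_iff (hn : ∀ k, 0 < n k) {N : SpecialLinearGroup (Σ k, Fin (n k) × σ k) ℂ} :
    N ∈ hodgeGroupC (sigmaPiPeriod fun k ↦ powPeriod (Ψ k) (n k)) ↔
      ∃ M ∈ hodgeGroupC (sigmaPiPeriod Ψ),
        (Matrix.blockDiagonal' fun k ↦ (1 : Matrix (Fin (n k)) (Fin (n k)) ℂ) ⊗ₖ Matrix.blockDiag' M.1 k) = N.1 := by
  rw [(isPolyGroupIso_sigmaDiagPowMap σ n fun k ↦ ⟨0, hn k⟩).mem_hodgeGroupC_iff (Φ := sigmaPiPeriod Ψ)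
    (Φ' := sigmaPiPeriod fun k ↦ powPeriod (Ψ k) (n k))
    (hodgeCircle_sigmaPiPeriod_mem_ratZeroLocus_sigmaPiEqs_empty Ψ)
    (peval_sigmaDiagPowMap_hodgeCircle_sigmaPiPeriod Ψ n)]
  refine exists_congr fun M ↦ and_congr_right fun _ ↦ ?_
  rw [peval_sigmaDiagPowMap]

/-- **`Hg(∏ₖ X_k^{n_k})(ℂ)` is commutative iff `Hg(∏ₖ X_k)(ℂ)` is** (`n_k ≥ 1`; the transport `δ` is a multiplicative
bijection). [cite: MoonenZarhin1999LowDim, §1 (p0002 L138–L141)] [cite: GreenGriffithsKerr2012, §I.B (I.B.4)] -/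
theorem hodgeGroupC_sigmaPi_pow_comm_iff (hn : ∀ k, 0 < n k) :
    (∀ M ∈ hodgeGroupC (sigmaPiPeriod fun k ↦ powPeriod (Ψ k) (n k)),
        ∀ N ∈ hodgeGroupC (sigmaPiPeriod fun k ↦ powPeriod (Ψ k) (n k)), M * N = N * M) ↔
      ∀ M ∈ hodgeGroupC (sigmaPiPeriod Ψ), ∀ N ∈ hodgeGroupC (sigmaPiPeriod Ψ), M * N = N * M :=
  (isPolyGroupIso_sigmaDiagPowMap σ n fun k ↦ ⟨0, hn k⟩).hodgeGroupC_comm_iff (Φ := sigmaPiPeriod Ψ)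
    (Φ' := sigmaPiPeriod fun k ↦ powPeriod (Ψ k) (n k))
    (hodgeCircle_sigmaPiPeriod_mem_ratZeroLocus_sigmaPiEqs_empty Ψ)
    (peval_sigmaDiagPowMap_hodgeCircle_sigmaPiPeriod Ψ n)

/-- **The same on real points: `Hg(∏ₖ X_k^{n_k})(ℝ)` is commutative iff `Hg(∏ₖ X_k)(ℝ)` is** (`n_k ≥ 1`).
[cite: MoonenZarhin1999LowDim, §1 (p0002 L138–L141)] -/
theorem hodgeGroup_sigmaPi_pow_comm_iff (hn : ∀ k, 0 < n k) :
    (∀ M N : hodgeGroup (sigmaPiPeriod fun k ↦ powPeriod (Ψ k) (n k)), M * N = N * M) ↔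
      ∀ M N : hodgeGroup (sigmaPiPeriod Ψ), M * N = N * M := by
  set e := hodgeGroupSigmaPiPowMulEquiv Ψ n hn
  constructor
  · intro h M N
    exact e.injective (by rw [map_mul, map_mul, h])
  · intro h M N
    obtain ⟨M', rfl⟩ := e.surjective M
    obtain ⟨N', rfl⟩ := e.surjective N
    rw [← map_mul, ← map_mul, h]

end HodgeGroup

/-! ## §4 `X ∼ Y₁^{m₁} × ⋯ × Y_r^{m_r}` ⟹ `Hg(X)(ℝ) ≃* Hg(Y₁ × ⋯ × Y_r)(ℝ)` -/

section Isogeny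

variable {κ : Type*} [Fintype κ] [DecidableEq κ] {σ : κ → Type*} [∀ k, Fintype (σ k)] [∀ k, DecidableEq (σ k)]
  {F : κ → Type*} [∀ k, NormedAddCommGroup (F k)] [∀ k, NormedSpace ℂ (F k)]
  {Ψ : ∀ k, (σ k → ℝ) ≃L[ℝ] F k} {n : κ → ℕ}
  {ι : Type*} [Fintype ι] [DecidableEq ι] {E : Type*} [NormedAddCommGroup E] [NormedSpace ℂ E]
  {Φ : (ι → ℝ) ≃L[ℝ] E}

/-- **"Decompose `X`, up to isogeny, … `X ∼ Y₁^{m₁} × ⋯ × Y_r^{m_r}`" + §1: `Hg(X)(ℝ) ≃* Hg(Y₁ × ⋯ × Y_r)(ℝ)`** for ANY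
tori `Y_k` of any dimensions and exponents `m_k ≥ 1` (`Hg` is an isogeny invariant,
`IsIsogenous.nonempty_hodgeGroup_mulEquiv`, composed with `hodgeGroupSigmaPiPowMulEquiv`).
[cite: MoonenZarhin1999LowDim, (0.2)(4) (p0002 L1–L3) and §1 (p0002 L138–L141)] -/
theorem IsIsogenous.nonempty_hodgeGroup_mulEquiv_sigmaPi_of_powers (hn : ∀ k, 0 < n k)
    (hX : IsIsogenous Φ (sigmaPiPeriod fun k ↦ powPeriod (Ψ k) (n k))) :
    Nonempty (hodgeGroup Φ ≃* hodgeGroup (sigmaPiPeriod Ψ)) := by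
  obtain ⟨e⟩ := hX.nonempty_hodgeGroup_mulEquiv
  exact ⟨e.trans (hodgeGroupSigmaPiPowMulEquiv Ψ n hn).symm⟩

/-- **For EVERY polarised complex torus: `Hg(X)(ℝ) ≃* Hg(Y₁ × ⋯ × Y_r)(ℝ)` for the simple, pairwise non-isogenous
Poincaré factors `Y_ν` of `X`** (`poincare_complete_reducibility_powers`: `X ∼ ∏_ν Y_ν^{n_ν}`).
[cite: MoonenZarhin1999LowDim, (0.2)(4) (p0002 L1–L3, L9–L11) and §1 (p0002 L138–L141)]
[cite: Lange2023AbelianVarietiesComplex, §2.4.4 Thm. 2.4.25] -/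
theorem IsRiemannForm.exists_nonempty_hodgeGroup_mulEquiv_sigmaPi_simple [FiniteDimensional ℂ E]
    {η : E [⋀^Fin 2]→L[ℝ] ℝ} (hη : IsRiemannForm Φ η) :
    ∃ (r : ℕ) (V : Fin r → Submodule ℝ (ι → ℝ)) (hV : ∀ ν, IsLatticeSubspace (V ν))
      (hVc : ∀ ν, IsComplexSubspace Φ (V ν)) (n : Fin r → ℕ),
      (∀ ν, IsSimple (subtorusPeriod Φ (V ν) (hV ν) (hVc ν))) ∧
      (∀ ν ν', ν ≠ ν' → ¬ IsIsogenous (subtorusPeriod Φ (V ν) (hV ν) (hVc ν))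
        (subtorusPeriod Φ (V ν') (hV ν') (hVc ν'))) ∧
      (∀ ν, 0 < n ν) ∧
      IsIsogenous Φ (sigmaPiPeriod fun ν ↦ powPeriod (subtorusPeriod Φ (V ν) (hV ν) (hVc ν)) (n ν)) ∧
      Nonempty (hodgeGroup Φ ≃* hodgeGroup (sigmaPiPeriod fun ν ↦ subtorusPeriod Φ (V ν) (hV ν) (hVc ν))) := by
  obtain ⟨r, V, hV, hVc, n, hsimple, -, hne, hpos, hiso⟩ := poincare_complete_reducibility_powers Φ hη
  exact ⟨r, V, hV, hVc, n, hsimple, hne, hpos, hiso,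
    IsIsogenous.nonempty_hodgeGroup_mulEquiv_sigmaPi_of_powers hpos hiso⟩

end Isogeny

end ComplexTorus

end Literature.Geometry.Kaehler

end
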